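import Summits.Ventures.HSemireg.WedgeHankelRecurrenceGaussKernel

/-!
# Venture HSemireg — **THE GAUSS–LOBATTO RULE**: from the `(t+1)`-point Gauss rule `(ν, w)` of `(x − c)(d − x)·σ` (exact in degree `≤ 2t + 1`), the `(t+3)`-point rule with the TWO
# PRESCRIBED nodes `c, d` — weights `λ_l = ν_l/((w_l − c)(d − w_l))` and `λ_c, λ_d` solving the first two moment equations — is exact for `σ` in degree `≤ 2t + 3`; for a positive discrete
# `σ` with `≥ t + 2` nodes in `(c, d)` every weight is positive

HONEST FRAMING. Part of the Lean index of the computation cell `pub-hsemireg` (seat p10 gen 42, Sunday typer «UNIFORM-IN-n»).  Real polynomials and finite sums only, on top of N264 ∕ N265 ∕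
N268; no variety, no cohomology theory, no sheaf, no Ext group and no semiregularity map is constructed here; nothing here says that HC / HC_CM / HC_AV holds; no Literature fact (unproved
`Prop`) is declared or used.  Custodian versions as in `WedgeHankelSiegelIdeal` (1/3).
SOURCES (cited).  R. Lobatto, *Lessen over de Differentiaal- en Integraal-Rekening* II (1852), §207; W. Gautschi, *A survey of Gauss–Christoffel quadrature formulae*, in: *E. B. Christoffel*
(Birkhäuser, 1981), §2.2.1 (Gauss–Lobatto: `n + 2` nodes, two of them the prescribed endpoints, degree of exactness `2n + 1`); G. Szegő, *Orthogonal Polynomials*, Thm 2.5 (orthogonal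
polynomials of `(x − c)(d − x) dα`); M. G. Krein, A. A. Nudel'man, *The Markov Moment Problem and Extremal Problems* (1977), Ch. III §3 (principal representations with endpoint nodes).
PROOF TYPED HERE.  `F(p) = Σ M V^p − Σ λ_l w_l^p − λ_c c^p − λ_d d^p` vanishes at `p = 0, 1` by the choice of `λ_c, λ_d` and satisfies `F(p+2) = (c + d) F(p+1) − cd F(p)` for `p ≤ 2t + 1`,
because `(V − c)(d − V) V^p = −V^{p+2} + (c + d) V^{p+1} − cd V^p` on both sides and `c, d` are roots of `−X² + (c+d)X − cd`.  Positivity of `λ_c` ∕ `λ_d`: test `(d − X) ∏(X − w_l)²` ∕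
`(X − c) ∏(X − w_l)²` (degree `2t + 3`).
DEDUP DISCLOSURE (`rg -n 'Lobatto|lobatto' Summits/Ventures/HSemireg Literature`, 2026-09-02): nothing in this lineage.  The 6 names below: 0 hits tree-wide.

WHAT IS IN THE TREE.  N264 `exists_node_le_gaussNode_zero`, `exists_gaussNode_last_le_node`; N265 `gauss_weight_pos`; N268 `exists_node_ne_of_lt_card`; Mathlib `Polynomial.eval_eq_sum_range'`.
THIS FILE (namespace `Summit.Ventures.HSemireg.Wedge.HankelOuter` continued; CHAINED on N277 (import), N264, N265, N268; 0 definitions):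
* §1043 `lobatto_step` (the two-step recurrence of the moment defects), **`gauss_lobatto_exact`** (exactness in degree `≤ 2t + 3`), `lobatto_eval_eq_of_exact` (polynomial form of exactness),
  `gauss_lobatto_nodes_mem_Ioo` (`c < w_l < d`, `ν_l > 0`, hence `λ_l > 0`), **`gauss_lobatto_weights_fixed_pos`** (`λ_c > 0` and `λ_d > 0`), **`gauss_lobatto`** (packaged).
CAVEATS.  Discrete integrating measure only; nothing Ext-side.  New names only.
-/

open Module Polynomial
open scoped Matrix Polynomial

namespace Summit.Ventures.HSemireg.Wedge.HankelOuter

/-! ## §1043. Gauss–Lobatto -/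

/-- **The two-step recurrence**: if `Σ_l ν_l w_l^p = Σ_l M_l (V_l − c)(d − V_l) V_l^p` and `λ_l (w_l − c)(d − w_l) = ν_l`, then with `F(p) = Σ M V^p − Σ λ w^p − λ_c c^p − λ_d d^p` (any
`λ_c, λ_d`): `F(p+2) = (c + d) F(p+1) − cd · F(p)`. [mechanism; this file, §1043] -/
theorem lobatto_step {t P : ℕ} {ν w lam : Fin (t + 1) → ℝ} {M V : Fin P → ℝ} {c d lc ld : ℝ} {p : ℕ}
    (hBp : ∑ l, ν l * w l ^ p = ∑ l, (M l * ((V l - c) * (d - V l))) * V l ^ p) (hlam : ∀ l, lam l * ((w l - c) * (d - w l)) = ν l) :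
    (∑ l, M l * V l ^ (p + 2) - ∑ l, lam l * w l ^ (p + 2) - lc * c ^ (p + 2) - ld * d ^ (p + 2))
      = (c + d) * (∑ l, M l * V l ^ (p + 1) - ∑ l, lam l * w l ^ (p + 1) - lc * c ^ (p + 1) - ld * d ^ (p + 1))
        - c * d * (∑ l, M l * V l ^ p - ∑ l, lam l * w l ^ p - lc * c ^ p - ld * d ^ p) := by
  have hM : ∑ l, (M l * ((V l - c) * (d - V l))) * V l ^ p = -∑ l, M l * V l ^ (p + 2) + (c + d) * ∑ l, M l * V l ^ (p + 1) - c * d * ∑ l, M l * V l ^ p := by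
    rw [Finset.mul_sum, Finset.mul_sum, ← Finset.sum_neg_distrib, ← Finset.sum_add_distrib, ← Finset.sum_sub_distrib]
    exact Finset.sum_congr rfl fun l _ => by ring
  have hL : ∑ l, ν l * w l ^ p = -∑ l, lam l * w l ^ (p + 2) + (c + d) * ∑ l, lam l * w l ^ (p + 1) - c * d * ∑ l, lam l * w l ^ p := by
    rw [Finset.mul_sum, Finset.mul_sum, ← Finset.sum_neg_distrib, ← Finset.sum_add_distrib, ← Finset.sum_sub_distrib]
    exact Finset.sum_congr rfl fun l _ => by rw [← hlam l]; ring
  rw [hM] at hBp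
  rw [hL] at hBp
  linear_combination hBp

/-- **GAUSS–LOBATTO EXACTNESS**: if `Σ_l ν_l w_l^p = Σ_l M_l (V_l − c)(d − V_l) V_l^p` for `p ≤ 2t + 1` (`c ≠ d`, `w_l ∉ {c, d}`), then with `λ_l = ν_l/((w_l − c)(d − w_l))`,
`S_0 = Σ M − Σ λ`, `S_1 = Σ M V − Σ λ w`, `λ_c = (d S_0 − S_1)/(d − c)`, `λ_d = (S_1 − c S_0)/(d − c)`:  `λ_c c^p + λ_d d^p + Σ_l λ_l w_l^p = Σ_l M_l V_l^p` for all `p ≤ 2t + 3`.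
[Lobatto 1852; Gautschi 1981 §2.2.1; this file, §1043] -/
theorem gauss_lobatto_exact {t P : ℕ} {ν w : Fin (t + 1) → ℝ} {M V : Fin P → ℝ} {c d : ℝ} (hcd : c ≠ d)
    (hB : ∀ p, p ≤ 2 * t + 1 → ∑ l, ν l * w l ^ p = ∑ l, (M l * ((V l - c) * (d - V l))) * V l ^ p) (hwc : ∀ l, w l ≠ c) (hwd : ∀ l, w l ≠ d) {p : ℕ} (hp : p ≤ 2 * t + 3) :
    (d * (∑ l, M l - ∑ l, ν l / ((w l - c) * (d - w l))) - (∑ l, M l * V l - ∑ l, ν l / ((w l - c) * (d - w l)) * w l)) / (d - c) * c ^ p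
      + ((∑ l, M l * V l - ∑ l, ν l / ((w l - c) * (d - w l)) * w l) - c * (∑ l, M l - ∑ l, ν l / ((w l - c) * (d - w l)))) / (d - c) * d ^ p
      + ∑ l, ν l / ((w l - c) * (d - w l)) * w l ^ p = ∑ l, M l * V l ^ p := by
  set lam : Fin (t + 1) → ℝ := fun l => ν l / ((w l - c) * (d - w l)) with hlamdef
  set S0 : ℝ := ∑ l, M l - ∑ l, lam l with hS0
  set S1 : ℝ := ∑ l, M l * V l - ∑ l, lam l * w l with hS1
  set lc : ℝ := (d * S0 - S1) / (d - c) with hlc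
  set ld : ℝ := (S1 - c * S0) / (d - c) with hld
  have hdc : d - c ≠ 0 := sub_ne_zero.2 (Ne.symm hcd)
  have hlam : ∀ l, lam l * ((w l - c) * (d - w l)) = ν l := fun l => by
    have h1 : w l - c ≠ 0 := sub_ne_zero.2 (hwc l)
    have h2 : d - w l ≠ 0 := sub_ne_zero.2 (Ne.symm (hwd l))
    rw [hlamdef]; field_simp
  set F : ℕ → ℝ := fun p => ∑ l, M l * V l ^ p - ∑ l, lam l * w l ^ p - lc * c ^ p - ld * d ^ p with hF
  have hF0 : F 0 = 0 := by
    simp only [hF, pow_zero, mul_one]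
    rw [hlc, hld]; field_simp; rw [hS0]; ring
  have hF1 : F 1 = 0 := by
    simp only [hF, pow_one]
    rw [hlc, hld]; field_simp; rw [hS1]; ring
  have hstep : ∀ p, p ≤ 2 * t + 1 → F (p + 2) = (c + d) * F (p + 1) - c * d * F p := fun p hp => lobatto_step (hB p hp) hlam
  -- two-step induction
  have hpair : ∀ p, p ≤ 2 * t + 2 → F p = 0 ∧ F (p + 1) = 0 := by
    intro p
    induction p with
    | zero => exact fun _ => ⟨hF0, hF1⟩
    | succ p ih =>
      intro hp'
      obtain ⟨h0, h1⟩ := ih (by omega)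
      refine ⟨h1, ?_⟩
      rw [show p + 1 + 1 = p + 2 by ring, hstep p (by omega), h0, h1]; ring
  have hFp : F p = 0 := by
    rcases (show p ≤ 2 * t + 2 ∨ p = 2 * t + 3 by omega) with h | h
    · exact (hpair p h).1
    · have := (hpair (2 * t + 2) le_rfl).2; rw [h]; exact this
  have : lc * c ^ p + ld * d ^ p + ∑ l, lam l * w l ^ p = ∑ l, M l * V l ^ p := by
    have e : F p = ∑ l, M l * V l ^ p - ∑ l, lam l * w l ^ p - lc * c ^ p - ld * d ^ p := rfl
    linarith [hFp, e]
  exact this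

/-- **Polynomial form of exactness**: moment identities up to degree `K` give `λ_c G(c) + λ_d G(d) + Σ λ G(w) = Σ M G(V)` for every `G` with `deg G ≤ K`. [bookkeeping; this file, §1043] -/
theorem lobatto_eval_eq_of_exact {m P K : ℕ} {lam w : Fin m → ℝ} {M V : Fin P → ℝ} {c d lc ld : ℝ}
    (hex : ∀ p, p ≤ K → lc * c ^ p + ld * d ^ p + ∑ l, lam l * w l ^ p = ∑ l, M l * V l ^ p) {G : ℝ[X]} (hG : G.natDegree ≤ K) :
    lc * G.eval c + ld * G.eval d + ∑ l, lam l * G.eval (w l) = ∑ l, M l * G.eval (V l) := by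
  have hev : ∀ y : ℝ, G.eval y = ∑ p ∈ Finset.range (K + 1), G.coeff p * y ^ p := fun y => eval_eq_sum_range' (Nat.lt_succ_of_le hG) y
  simp_rw [hev, Finset.mul_sum]
  rw [Finset.sum_comm (f := fun l p => lam l * (G.coeff p * w l ^ p)), Finset.sum_comm (f := fun l p => M l * (G.coeff p * V l ^ p)), ← Finset.sum_add_distrib, ← Finset.sum_add_distrib]
  refine Finset.sum_congr rfl fun p hp => ?_
  have h := hex p (by have := Finset.mem_range.1 hp; omega)
  have e1 : ∑ l, lam l * (G.coeff p * w l ^ p) = G.coeff p * ∑ l, lam l * w l ^ p := by rw [Finset.mul_sum]; exact Finset.sum_congr rfl fun l _ => by ring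
  have e2 : ∑ l, M l * (G.coeff p * V l ^ p) = G.coeff p * ∑ l, M l * V l ^ p := by rw [Finset.mul_sum]; exact Finset.sum_congr rfl fun l _ => by ring
  rw [e1, e2, ← h]
  ring

/-- **For a positive measure inside `(c, d)` the Gauss nodes of `(x − c)(d − x)σ` lie in `(c, d)` and its weights are positive** (so every `λ_l > 0`). [N265 + N264; this file, §1043] -/
theorem gauss_lobatto_nodes_mem_Ioo {t P : ℕ} {ν w : Fin (t + 1) → ℝ} {M V : Fin P → ℝ} {c d : ℝ} (hM : ∀ l, 0 < M l) (hV : Function.Injective V) (hP : t + 1 ≤ P)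
    (hcV : ∀ l, c < V l) (hVd : ∀ l, V l < d) (hw : StrictMono w) (hB : ∀ p, p ≤ 2 * t + 1 → ∑ l, ν l * w l ^ p = ∑ l, (M l * ((V l - c) * (d - V l))) * V l ^ p) :
    (∀ l, 0 < ν l) ∧ (∀ l, c < w l ∧ w l < d) ∧ ∀ l, 0 < ν l / ((w l - c) * (d - w l)) := by
  have hMc : ∀ l, 0 < M l * ((V l - c) * (d - V l)) := fun l => mul_pos (hM l) (mul_pos (sub_pos.2 (hcV l)) (sub_pos.2 (hVd l)))
  have hν : ∀ l, 0 < ν l := gauss_weight_pos (ν := fun l => M l * ((V l - c) * (d - V l))) hw.injective hMc hV hP (fun p hp => hB p (by omega))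
  obtain ⟨l₀, hl₀⟩ := exists_node_le_gaussNode_zero (ν := fun l => M l * ((V l - c) * (d - V l))) hν hw hMc hB
  obtain ⟨l₁, hl₁⟩ := exists_gaussNode_last_le_node (ν := fun l => M l * ((V l - c) * (d - V l))) hν hw hMc hB
  have hcw : ∀ l, c < w l := fun l => lt_of_lt_of_le (lt_of_lt_of_le (hcV l₀) hl₀) (hw.monotone (Fin.zero_le l))
  have hwd : ∀ l, w l < d := fun l => lt_of_le_of_lt ((hw.monotone (Fin.le_last l)).trans hl₁) (hVd l₁)
  exact ⟨hν, fun l => ⟨hcw l, hwd l⟩, fun l => div_pos (hν l) (mul_pos (sub_pos.2 (hcw l)) (sub_pos.2 (hwd l)))⟩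

/-- **The weights at the prescribed nodes are positive**: `λ_c > 0` and `λ_d > 0` for a positive measure with at least `t + 2` distinct nodes in `(c, d)` (test polynomials
`(d − X) ∏(X − w_l)²` and `(X − c) ∏(X − w_l)²`, degree `2t + 3`). [Gautschi 1981 §2.2.1; Krein–Nudel'man III §3; this file, §1043] -/
theorem gauss_lobatto_weights_fixed_pos {t P : ℕ} {ν w : Fin (t + 1) → ℝ} {M V : Fin P → ℝ} {c d : ℝ} (hM : ∀ l, 0 < M l) (hV : Function.Injective V) (hP : t + 2 ≤ P)
    (hcV : ∀ l, c < V l) (hVd : ∀ l, V l < d) (hw : StrictMono w) (hB : ∀ p, p ≤ 2 * t + 1 → ∑ l, ν l * w l ^ p = ∑ l, (M l * ((V l - c) * (d - V l))) * V l ^ p) :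
    0 < (d * (∑ l, M l - ∑ l, ν l / ((w l - c) * (d - w l))) - (∑ l, M l * V l - ∑ l, ν l / ((w l - c) * (d - w l)) * w l)) / (d - c) ∧
      0 < ((∑ l, M l * V l - ∑ l, ν l / ((w l - c) * (d - w l)) * w l) - c * (∑ l, M l - ∑ l, ν l / ((w l - c) * (d - w l)))) / (d - c) := by
  have hP' : t + 1 ≤ P := by omega
  obtain ⟨-, hcwd, -⟩ := gauss_lobatto_nodes_mem_Ioo hM hV hP' hcV hVd hw hB
  obtain ⟨l, -⟩ : ∃ l : Fin P, True := ⟨⟨0, by omega⟩, trivial⟩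
  have hcd : c < d := (hcV l).trans (hVd l)
  have hwc : ∀ l, w l ≠ c := fun l => (hcwd l).1.ne'
  have hwd : ∀ l, w l ≠ d := fun l => (hcwd l).2.ne
  have hex := fun p (hp : p ≤ 2 * t + 3) => gauss_lobatto_exact hcd.ne hB hwc hwd hp
  set lc := (d * (∑ l, M l - ∑ l, ν l / ((w l - c) * (d - w l))) - (∑ l, M l * V l - ∑ l, ν l / ((w l - c) * (d - w l)) * w l)) / (d - c) with hlc
  set ld := ((∑ l, M l * V l - ∑ l, ν l / ((w l - c) * (d - w l)) * w l) - c * (∑ l, M l - ∑ l, ν l / ((w l - c) * (d - w l)))) / (d - c) with hld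
  set Q : ℝ[X] := ∏ l, (Polynomial.X - C (w l)) ^ 2 with hQ
  have hQdeg : Q.natDegree = 2 * t + 2 := by
    rw [hQ, natDegree_prod_of_monic _ _ fun l _ => (monic_X_sub_C (w l)).pow 2]
    simp only [(monic_X_sub_C _).natDegree_pow, natDegree_X_sub_C, Finset.sum_const, Finset.card_univ, Fintype.card_fin, smul_eq_mul]; ring
  have hQw : ∀ l, Q.eval (w l) = 0 := fun l => by
    rw [hQ, eval_prod]; exact Finset.prod_eq_zero (Finset.mem_univ l) (by rw [eval_pow, eval_sub, eval_X, eval_C, sub_self, zero_pow two_ne_zero])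
  have hQnn : ∀ y, 0 ≤ Q.eval y := fun y => by rw [hQ, eval_prod]; exact Finset.prod_nonneg fun j _ => by rw [eval_pow]; exact sq_nonneg _
  obtain ⟨l₁, hl₁⟩ := exists_node_ne_of_lt_card (v := w) hV (by omega)
  have hQpos : ∀ {y}, (∀ j, y ≠ w j) → 0 < Q.eval y := fun {y} hy => by
    rw [hQ, eval_prod]
    refine Finset.prod_pos fun j _ => ?_
    have hne : y - w j ≠ 0 := sub_ne_zero.2 (hy j)
    rw [eval_pow, eval_sub, eval_X, eval_C]; positivity
  have hQc : 0 < Q.eval c := hQpos fun j => (hwc j).symm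
  have hQd : 0 < Q.eval d := hQpos fun j => (hwd j).symm
  have hQV : 0 < Q.eval (V l₁) := hQpos hl₁
  constructor
  · -- test `(d − X) Q`
    have hG : ((C d - Polynomial.X) * Q).natDegree ≤ 2 * t + 3 := by
      refine natDegree_mul_le.trans ?_
      rw [hQdeg]
      have : (C d - Polynomial.X).natDegree ≤ 1 := (natDegree_sub_le _ _).trans (by rw [natDegree_C, natDegree_X]; exact max_le zero_le_one le_rfl)
      omega
    have h := lobatto_eval_eq_of_exact hex hG
    simp only [eval_mul, eval_sub, eval_C, eval_X, sub_self, zero_mul, mul_zero, hQw] at h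
    rw [Finset.sum_const_zero, add_zero] at h
    have hrhs : 0 < ∑ l, M l * ((d - V l) * Q.eval (V l)) := by
      have hnn : ∀ l ∈ (Finset.univ : Finset (Fin P)), 0 ≤ M l * ((d - V l) * Q.eval (V l)) := fun l _ => mul_nonneg (hM l).le (mul_nonneg (sub_pos.2 (hVd l)).le (hQnn _))
      exact lt_of_lt_of_le (mul_pos (hM l₁) (mul_pos (sub_pos.2 (hVd l₁)) hQV)) (Finset.single_le_sum hnn (Finset.mem_univ l₁))
    rw [← h] at hrhs
    by_contra hle; rw [not_lt] at hle
    have : lc * ((d - c) * Q.eval c) ≤ 0 := mul_nonpos_iff.2 (Or.inr ⟨hle, (mul_pos (sub_pos.2 hcd) hQc).le⟩)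
    linarith
  · -- test `(X − c) Q`
    have hG : ((Polynomial.X - C c) * Q).natDegree ≤ 2 * t + 3 := by
      refine natDegree_mul_le.trans ?_
      rw [hQdeg, natDegree_X_sub_C]; omega
    have h := lobatto_eval_eq_of_exact hex hG
    simp only [eval_mul, eval_sub, eval_C, eval_X, sub_self, zero_mul, mul_zero, zero_add, hQw] at h
    rw [Finset.sum_const_zero, add_zero] at h
    have hrhs : 0 < ∑ l, M l * ((V l - c) * Q.eval (V l)) := by
      have hnn : ∀ l ∈ (Finset.univ : Finset (Fin P)), 0 ≤ M l * ((V l - c) * Q.eval (V l)) := fun l _ => mul_nonneg (hM l).le (mul_nonneg (sub_pos.2 (hcV l)).le (hQnn _))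
      exact lt_of_lt_of_le (mul_pos (hM l₁) (mul_pos (sub_pos.2 (hcV l₁)) hQV)) (Finset.single_le_sum hnn (Finset.mem_univ l₁))
    rw [← h] at hrhs
    by_contra hle; rw [not_lt] at hle
    have : ld * ((d - c) * Q.eval d) ≤ 0 := mul_nonpos_iff.2 (Or.inr ⟨hle, (mul_pos (sub_pos.2 hcd) hQd).le⟩)
    linarith

/-- **THE GAUSS–LOBATTO RULE (packaged)**: for a positive discrete measure `(M, V)` with at least `t + 2` distinct nodes, all in `(c, d)`, and `(ν, w)` the `(t+1)`-point Gauss rule of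
`(x − c)(d − x)·(M, V)` (increasing nodes, exact in degree `≤ 2t + 1`), the rule on `c, w_0, …, w_t, d` with the weights above is exact in degree `≤ 2t + 3` and all `t + 3` weights are
positive. [Lobatto 1852; Gautschi 1981 §2.2.1; this file, §1043] -/
theorem gauss_lobatto {t P : ℕ} {ν w : Fin (t + 1) → ℝ} {M V : Fin P → ℝ} {c d : ℝ} (hM : ∀ l, 0 < M l) (hV : Function.Injective V) (hP : t + 2 ≤ P)
    (hcV : ∀ l, c < V l) (hVd : ∀ l, V l < d) (hw : StrictMono w) (hB : ∀ p, p ≤ 2 * t + 1 → ∑ l, ν l * w l ^ p = ∑ l, (M l * ((V l - c) * (d - V l))) * V l ^ p) :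
    (∀ p, p ≤ 2 * t + 3 →
      (d * (∑ l, M l - ∑ l, ν l / ((w l - c) * (d - w l))) - (∑ l, M l * V l - ∑ l, ν l / ((w l - c) * (d - w l)) * w l)) / (d - c) * c ^ p
        + ((∑ l, M l * V l - ∑ l, ν l / ((w l - c) * (d - w l)) * w l) - c * (∑ l, M l - ∑ l, ν l / ((w l - c) * (d - w l)))) / (d - c) * d ^ p
        + ∑ l, ν l / ((w l - c) * (d - w l)) * w l ^ p = ∑ l, M l * V l ^ p) ∧
    0 < (d * (∑ l, M l - ∑ l, ν l / ((w l - c) * (d - w l))) - (∑ l, M l * V l - ∑ l, ν l / ((w l - c) * (d - w l)) * w l)) / (d - c) ∧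
    0 < ((∑ l, M l * V l - ∑ l, ν l / ((w l - c) * (d - w l)) * w l) - c * (∑ l, M l - ∑ l, ν l / ((w l - c) * (d - w l)))) / (d - c) ∧
    (∀ l, 0 < ν l / ((w l - c) * (d - w l))) ∧ ∀ l, c < w l ∧ w l < d := by
  obtain ⟨-, hcwd, hlam⟩ := gauss_lobatto_nodes_mem_Ioo hM hV (by omega) hcV hVd hw hB
  obtain ⟨l, -⟩ : ∃ l : Fin P, True := ⟨⟨0, by omega⟩, trivial⟩
  have hcd : c ≠ d := ((hcV l).trans (hVd l)).ne
  obtain ⟨h1, h2⟩ := gauss_lobatto_weights_fixed_pos hM hV hP hcV hVd hw hB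
  exact ⟨fun p hp => gauss_lobatto_exact hcd hB (fun l => (hcwd l).1.ne') (fun l => (hcwd l).2.ne) hp, h1, h2, hlam, hcwd⟩

end Summit.Ventures.HSemireg.Wedge.HankelOuter
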